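/-
Copyright (c) 2026. Released under Apache 2.0 license.
Literature formalization: Chen–Voutier, Lemmas 2, 3 and 5 (the Padé remainder along an arc).
-/
import Mathlib
import Literature.NumberTheory.DiophantineApproximation.BinomialPadeIdentities

/-!
# The remainder of the Padé approximants to `x ^ α` at `x = 1`, along an arc of the unit circle

[cite: ChenVoutier1997, Lemma 2, Lemma 3 and Lemma 5 (arXiv:1401.5450, Lemmas 2.4, 2.5, 2.7)]

J. H. Chen and P. M. Voutier, *Complete solution of the Diophantine equation `X² + 1 = dY⁴` and a
related family of quartic Thue equations*, J. Number Theory **62** (1997), 71–99.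

With `p_m(X) = ∑_{ν=0}^{m} C(m-α,m-ν) C(n+α,ν) X^ν`, `q_n(X) = ∑_{ν=0}^{n} C(m-α,ν) C(n+α,n-ν) X^ν`
(Lemma 2), the remainder `r(x) = x^α q_n(x) - p_m(x)` is
`α C(m-α,m) C(n+α,n) ∫_1^x (t-x)^m (1-t)^n t^{α-m-1} dt` (Lemma 2), and for `x = w = e^{iφ}` on the
unit circle the integral may be taken along the arc `t = e^{iθ}`, `0 ≤ θ ≤ φ` and bounded by
`φ |1 - √w|^{2r}` when `m = n = r` (Lemma 5, where `|(1-t)(t-w)| ≤ |1-√w|²` on the arc).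

We prove these statements directly ON THE ARC, parametrising `t = e^{iθ}` and `t^α = e^{iαθ}`:

* `binomialPade_remainder_arc` : for `n ≤ m` and real `φ`,
  `e^{iαφ} q_n(e^{iφ}) - p_m(e^{iφ})
     = (-1)^m α C(m-α,m) C(n+α,n) · i ∫_0^φ e^{i(α-m)θ} (1 - e^{iθ})^n (e^{iφ} - e^{iθ})^m dθ`
  (which is Lemma 2's formula with `t = e^{iθ}`, `dt = i e^{iθ} dθ`, `(t-x)^m = (-1)^m (x-t)^m`);
* `binomialPade_remainder_arc_norm_le` : for `m = n = r` and `0 ≤ φ ≤ 2π`,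
  `‖e^{iαφ} q_r(e^{iφ}) - p_r(e^{iφ})‖ ≤ |α C(r-α,r) C(r+α,r)| · φ · ‖1 - e^{iφ/2}‖^{2r}`
  (Lemma 5's bound, the constant `α C(r+α,r)` being `Γ(r+1+α)/(r! Γ(α))`-free here because we
  keep Lemma 2's normalisation `p_r = C(r-α,r) X_{n,r}` of Lemma 3).

The proof follows the printed one (Taylor's formula with integral remainder at `x₀ = 1`, the
vanishing `r^{(k)}(1) = 0` for `k ≤ m` and the closed form of `r^{(m+1)}`, all from
`BinomialPadeIdentities`), except that Taylor's formula is obtained by differentiating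
`θ ↦ ∑_{k ≤ m} (r^{(k)}/k!)(e^{iθ}) (x - e^{iθ})^k` along the arc (a telescoping sum), so that
neither a complex logarithm nor Cauchy's theorem is needed.
-/

open Finset Complex MeasureTheory intervalIntegral

namespace Literature.NumberTheory.DiophantineApproximation

/-! ### Calculus along the arc `θ ↦ e^{iθ}` -/

/-- `d/dθ e^{ieθ} = i e · e^{ieθ}` [folklore]. -/
theorem hasDerivAt_cexp_mul_I (e θ : ℝ) :
    HasDerivAt (fun θ : ℝ => cexp (↑(e * θ) * I)) (↑e * I * cexp (↑(e * θ) * I)) θ := by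
  have h1 : HasDerivAt (fun θ : ℝ => e * θ) e θ := by
    simpa using (hasDerivAt_id θ).const_mul e
  convert (h1.ofReal_comp.mul_const I).cexp using 1
  simp only [ofReal_mul]
  ring

/-- `d/dθ e^{iθ} = i e^{iθ}` [folklore]. -/
theorem hasDerivAt_cexp_I (θ : ℝ) :
    HasDerivAt (fun θ : ℝ => cexp (↑θ * I)) (I * cexp (↑θ * I)) θ := by
  have := hasDerivAt_cexp_mul_I 1 θ
  simp only [one_mul, ofReal_one] at this
  exact this

/-- Derivative of a finite sum of generalised monomials along the arc [folklore]. -/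
theorem hasDerivAt_sum_cexp_mul_I (s : Finset ℕ) (c : ℕ → ℂ) (e : ℕ → ℝ) (θ : ℝ) :
    HasDerivAt (fun θ : ℝ => ∑ ν ∈ s, c ν * cexp (↑(e ν * θ) * I))
      (∑ ν ∈ s, c ν * (↑(e ν) * I * cexp (↑(e ν * θ) * I))) θ :=
  HasDerivAt.fun_sum fun ν _ => (hasDerivAt_cexp_mul_I (e ν) θ).const_mul (c ν)

/-- `e^{i(e-1)θ} e^{iθ} = e^{ieθ}` [folklore]. -/
theorem cexp_sub_one_mul_I_mul (e θ : ℝ) :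
    cexp (↑((e - 1) * θ) * I) * cexp (↑θ * I) = cexp (↑(e * θ) * I) := by
  rw [← Complex.exp_add]
  congr 1
  push_cast
  ring

/-- `e^{iνθ} = (e^{iθ})^ν` [folklore]. -/
theorem cexp_natCast_mul_I (ν : ℕ) (θ : ℝ) :
    cexp (↑((ν : ℝ) * θ) * I) = cexp (↑θ * I) ^ ν := by
  rw [← Complex.exp_nat_mul]
  congr 1
  push_cast
  ring

/-- `e^{i(a+ν)θ} = e^{iaθ} (e^{iθ})^ν` [folklore]. -/
theorem cexp_add_natCast_mul_I (a : ℝ) (ν : ℕ) (θ : ℝ) :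
    cexp (↑((a + ν) * θ) * I) = cexp (↑(a * θ) * I) * cexp (↑θ * I) ^ ν := by
  rw [← cexp_natCast_mul_I, ← Complex.exp_add]
  congr 1
  push_cast
  ring

/-- The telescoping derivative behind Taylor's formula with integral remainder: if
`f_k' = (k+1) f_{k+1} g'` for `k ≤ m`, then
`d/dθ ∑_{k ≤ m} f_k (x - g)^k = (m+1) f_{m+1} g' (x - g)^m` [folklore]. -/
theorem hasDerivAt_taylor_telescope {m : ℕ} {f : ℕ → ℝ → ℂ} {f' : ℕ → ℂ} {g : ℝ → ℂ}
    {g' x : ℂ} {θ : ℝ} (hf : ∀ k ∈ range (m + 1), HasDerivAt (f k) (f' k) θ)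
    (hrel : ∀ k ∈ range (m + 1), f' k = (k + 1) * f (k + 1) θ * g') (hg : HasDerivAt g g' θ) :
    HasDerivAt (fun θ => ∑ k ∈ range (m + 1), f k θ * (x - g θ) ^ k)
      ((m + 1) * f (m + 1) θ * g' * (x - g θ) ^ m) θ := by
  have h : HasDerivAt (fun θ => ∑ k ∈ range (m + 1), f k θ * (x - g θ) ^ k)
      (∑ k ∈ range (m + 1),
        (f' k * (x - g θ) ^ k + f k θ * (↑k * (x - g θ) ^ (k - 1) * -g'))) θ :=
    HasDerivAt.fun_sum fun k hk => (hf k hk).mul ((hg.const_sub x).pow k)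
  convert h using 1
  rw [sum_add_distrib, sum_range_succ (fun k => f' k * (x - g θ) ^ k),
    sum_range_succ' (fun k => f k θ * (↑k * (x - g θ) ^ (k - 1) * -g'))]
  simp only [Nat.cast_zero, zero_mul, mul_zero, add_zero, Nat.add_sub_cancel]
  rw [hrel m (self_mem_range_succ m)]
  have hz : ∑ k ∈ range m, f' k * (x - g θ) ^ k +
      ∑ k ∈ range m, f (k + 1) θ * (((k + 1 : ℕ) : ℂ) * (x - g θ) ^ k * -g') = 0 := by
    rw [← sum_add_distrib]
    refine sum_eq_zero fun k hk => ?_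
    rw [hrel k (mem_range.mpr (by have := mem_range.mp hk; omega))]
    push_cast
    ring
  linear_combination -hz

/-! ### The trigonometric inequality of Lemma 5 -/

/-- `|1 - e^{iθ}|² = 2 - 2 cos θ` [folklore]. -/
theorem normSq_one_sub_cexp (θ : ℝ) : normSq (1 - cexp (↑θ * I)) = 2 - 2 * Real.cos θ := by
  rw [normSq_apply, sub_re, sub_im, one_re, one_im, exp_ofReal_mul_I_re, exp_ofReal_mul_I_im]
  nlinarith [Real.sin_sq_add_cos_sq θ]

/-- `|e^{iφ} - e^{iθ}|² = 2 - 2 cos (φ - θ)` [folklore]. -/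
theorem normSq_cexp_sub_cexp (φ θ : ℝ) :
    normSq (cexp (↑φ * I) - cexp (↑θ * I)) = 2 - 2 * Real.cos (φ - θ) := by
  rw [normSq_apply, sub_re, sub_im, exp_ofReal_mul_I_re, exp_ofReal_mul_I_im,
    exp_ofReal_mul_I_re, exp_ofReal_mul_I_im, Real.cos_sub]
  nlinarith [Real.sin_sq_add_cos_sq θ, Real.sin_sq_add_cos_sq φ]

/-- The inequality `F(θ) ≤ F(φ/2)` of [cite: ChenVoutier1997, proof of Lemma 5]:
`(2 - 2cos θ)(2 - 2cos(φ - θ)) ≤ (2 - 2cos(φ/2))²` for `0 ≤ θ ≤ φ ≤ 2π`. -/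
theorem two_sub_two_cos_mul_le {θ φ : ℝ} (h0 : 0 ≤ θ) (h1 : θ ≤ φ) (h2 : φ ≤ 2 * Real.pi) :
    (2 - 2 * Real.cos θ) * (2 - 2 * Real.cos (φ - θ)) ≤ (2 - 2 * Real.cos (φ / 2)) ^ 2 := by
  set a := θ / 2 with ha
  set b := (φ - θ) / 2 with hb
  have e1 : 2 - 2 * Real.cos θ = 4 * Real.sin a ^ 2 := by
    rw [Real.sin_sq_eq_half_sub, ha]; ring_nf
  have e2 : 2 - 2 * Real.cos (φ - θ) = 4 * Real.sin b ^ 2 := by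
    rw [Real.sin_sq_eq_half_sub, hb]; ring_nf
  have e3 : 2 - 2 * Real.cos (φ / 2) = 4 * Real.sin ((a + b) / 2) ^ 2 := by
    rw [Real.sin_sq_eq_half_sub, ha, hb]; ring_nf
  have hsa : 0 ≤ Real.sin a := Real.sin_nonneg_of_nonneg_of_le_pi (by linarith) (by linarith)
  have hsb : 0 ≤ Real.sin b := Real.sin_nonneg_of_nonneg_of_le_pi (by linarith) (by linarith)
  have hprod : Real.sin a * Real.sin b = (Real.cos (a - b) - Real.cos (a + b)) / 2 := by
    rw [Real.cos_sub, Real.cos_add]; ring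
  have hsq : Real.sin ((a + b) / 2) ^ 2 = (1 - Real.cos (a + b)) / 2 := by
    rw [Real.sin_sq_eq_half_sub]; ring_nf
  have hle : Real.sin a * Real.sin b ≤ Real.sin ((a + b) / 2) ^ 2 := by
    rw [hprod, hsq]
    linarith [Real.cos_le_one (a - b)]
  have hnn : 0 ≤ Real.sin a * Real.sin b := mul_nonneg hsa hsb
  rw [e1, e2, e3]
  nlinarith [mul_le_mul hle hle hnn (hnn.trans hle)]

/-- On the arc: `|1 - e^{iθ}| · |e^{iφ} - e^{iθ}| ≤ |1 - e^{iφ/2}|²` for `0 ≤ θ ≤ φ ≤ 2π`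
[cite: ChenVoutier1997, proof of Lemma 5, `F(θ) ≤ F(φ/2) = |1 - √w|⁴`]. -/
theorem norm_one_sub_cexp_mul_norm_sub_le {θ φ : ℝ} (h0 : 0 ≤ θ) (h1 : θ ≤ φ)
    (h2 : φ ≤ 2 * Real.pi) :
    ‖1 - cexp (↑θ * I)‖ * ‖cexp (↑φ * I) - cexp (↑θ * I)‖ ≤ ‖1 - cexp (↑(φ / 2) * I)‖ ^ 2 := by
  have hsq : (‖1 - cexp (↑θ * I)‖ * ‖cexp (↑φ * I) - cexp (↑θ * I)‖) ^ 2 ≤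
      (‖1 - cexp (↑(φ / 2) * I)‖ ^ 2) ^ 2 := by
    rw [mul_pow, Complex.sq_norm, Complex.sq_norm, Complex.sq_norm, normSq_one_sub_cexp,
      normSq_cexp_sub_cexp, normSq_one_sub_cexp]
    exact two_sub_two_cos_mul_le h0 h1 h2
  exact (sq_le_sq₀ (by positivity) (by positivity)).mp hsq


/-! ### The Taylor coefficients `r^{(k)}/k!` along the arc -/

/-- Algebraic kernel of the derivative rule for one monomial [folklore]. -/
theorem taylorCoeff_term_deriv (k : ℕ) {Q Ck Ck1 A : ℝ} (E1 E0 : ℂ)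
    (h : ((k : ℝ) + 1) * Ck1 = A * Ck) :
    ((k : ℂ) + 1) * (((Q * Ck1 : ℝ) : ℂ) * E1) * (I * E0) =
      ((Q * Ck : ℝ) : ℂ) * ((A : ℂ) * I * (E1 * E0)) := by
  have h' := congrArg (fun r : ℝ => (r : ℂ)) h
  push_cast at h' ⊢
  linear_combination ((Q : ℂ) * I * E1 * E0) * h'

/-- `d/dθ (r^{(k)}/k!)(e^{iθ}) = (k+1) (r^{(k+1)}/(k+1)!)(e^{iθ}) · i e^{iθ}` for the explicit
Taylor coefficients
`r^{(k)}(x)/k! = ∑_ν C(m-α,ν)C(n+α,n-ν)C(ν+α,k) x^{α+ν-k} - ∑_ν C(m-α,m-ν)C(n+α,ν)C(ν,k) x^{ν-k}`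
of [cite: ChenVoutier1997, proof of Lemma 2, first display], on the arc `x = e^{iθ}`. -/
theorem hasDerivAt_padeTaylorCoeff (α : ℝ) (m n k : ℕ) (θ : ℝ) :
    HasDerivAt (fun θ : ℝ =>
        ∑ ν ∈ range (n + 1), ((Ring.choose ((m : ℝ) - α) ν * Ring.choose ((n : ℝ) + α) (n - ν) *
            Ring.choose ((ν : ℝ) + α) k : ℝ) : ℂ) * cexp (↑(((ν : ℝ) + α - k) * θ) * I) -
        ∑ ν ∈ range (m + 1), ((Ring.choose ((m : ℝ) - α) (m - ν) * Ring.choose ((n : ℝ) + α) ν *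
            Ring.choose (ν : ℝ) k : ℝ) : ℂ) * cexp (↑(((ν : ℝ) - k) * θ) * I))
      ((k + 1) *
        (∑ ν ∈ range (n + 1), ((Ring.choose ((m : ℝ) - α) ν * Ring.choose ((n : ℝ) + α) (n - ν) *
            Ring.choose ((ν : ℝ) + α) (k + 1) : ℝ) : ℂ) *
              cexp (↑(((ν : ℝ) + α - ↑(k + 1)) * θ) * I) -
          ∑ ν ∈ range (m + 1), ((Ring.choose ((m : ℝ) - α) (m - ν) * Ring.choose ((n : ℝ) + α) ν *
            Ring.choose (ν : ℝ) (k + 1) : ℝ) : ℂ) * cexp (↑(((ν : ℝ) - ↑(k + 1)) * θ) * I)) *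
        (I * cexp (↑θ * I))) θ := by
  refine ((hasDerivAt_sum_cexp_mul_I (range (n + 1))
      (fun ν => ((Ring.choose ((m : ℝ) - α) ν * Ring.choose ((n : ℝ) + α) (n - ν) *
        Ring.choose ((ν : ℝ) + α) k : ℝ) : ℂ)) (fun ν => (ν : ℝ) + α - k) θ).sub
    (hasDerivAt_sum_cexp_mul_I (range (m + 1))
      (fun ν => ((Ring.choose ((m : ℝ) - α) (m - ν) * Ring.choose ((n : ℝ) + α) ν *
        Ring.choose (ν : ℝ) k : ℝ) : ℂ)) (fun ν => (ν : ℝ) - k) θ)).congr_deriv ?_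
  symm
  rw [mul_sub, sub_mul, mul_sum, mul_sum, sum_mul, sum_mul]
  congr 1
  · refine sum_congr rfl fun ν _ => ?_
    have h2 : cexp (↑(((ν : ℝ) + α - ↑(k + 1)) * θ) * I) * cexp (↑θ * I) =
        cexp (↑(((ν : ℝ) + α - k) * θ) * I) := by
      rw [← Complex.exp_add]
      congr 1
      push_cast
      ring
    rw [← h2]
    exact taylorCoeff_term_deriv k _ _ (succ_mul_ring_choose_succ ((ν : ℝ) + α) k)
  · refine sum_congr rfl fun ν _ => ?_
    have h2 : cexp (↑(((ν : ℝ) - ↑(k + 1)) * θ) * I) * cexp (↑θ * I) =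
        cexp (↑(((ν : ℝ) - k) * θ) * I) := by
      rw [← Complex.exp_add]
      congr 1
      push_cast
      ring
    rw [← h2]
    exact taylorCoeff_term_deriv k _ _ (succ_mul_ring_choose_succ (ν : ℝ) k)

/-- At `θ = 0` (i.e. `x = 1`) the Taylor coefficients vanish for `k ≤ m`: the Padé property
[cite: ChenVoutier1997, proof of Lemma 2, "Hence r^{(k)}(1)/k! = 0 for k = 0, 1, …, m"]. -/
theorem padeTaylorCoeff_zero (α : ℝ) {m k : ℕ} (n : ℕ) (hk : k ≤ m) :
    ∑ ν ∈ range (n + 1), ((Ring.choose ((m : ℝ) - α) ν * Ring.choose ((n : ℝ) + α) (n - ν) *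
        Ring.choose ((ν : ℝ) + α) k : ℝ) : ℂ) * cexp (↑(((ν : ℝ) + α - k) * (0 : ℝ)) * I) -
      ∑ ν ∈ range (m + 1), ((Ring.choose ((m : ℝ) - α) (m - ν) * Ring.choose ((n : ℝ) + α) ν *
        Ring.choose (ν : ℝ) k : ℝ) : ℂ) * cexp (↑(((ν : ℝ) - k) * (0 : ℝ)) * I) = 0 := by
  simp only [mul_zero, ofReal_zero, zero_mul, Complex.exp_zero, mul_one]
  rw [← Complex.ofReal_sum, ← Complex.ofReal_sum, ← Complex.ofReal_sub, Complex.ofReal_eq_zero,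
    sub_eq_zero, sum_qcoeff_mul_choose_eq_sum_pcoeff_mul_choose α n hk]

/-- The coefficient of order `m + 1` in closed form on the arc:
`(r^{(m+1)}/(m+1)!)(e^{iθ}) = (-1)^m (α/(m+1)) C(m-α,m) C(n+α,n) e^{i(α-m-1)θ} (1 - e^{iθ})^n`
[cite: ChenVoutier1997, proof of Lemma 2, display beginning `r^{(m+1)}(x)/(m+1)!`]. -/
theorem padeTaylorCoeff_succ (α : ℝ) {m n : ℕ} (hnm : n ≤ m) (θ : ℝ) :
    ∑ ν ∈ range (n + 1), ((Ring.choose ((m : ℝ) - α) ν * Ring.choose ((n : ℝ) + α) (n - ν) *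
        Ring.choose ((ν : ℝ) + α) (m + 1) : ℝ) : ℂ) * cexp (↑(((ν : ℝ) + α - ↑(m + 1)) * θ) * I) -
      ∑ ν ∈ range (m + 1), ((Ring.choose ((m : ℝ) - α) (m - ν) * Ring.choose ((n : ℝ) + α) ν *
        Ring.choose (ν : ℝ) (m + 1) : ℝ) : ℂ) * cexp (↑(((ν : ℝ) - ↑(m + 1)) * θ) * I) =
    (((-1) ^ m * (α / (m + 1)) * Ring.choose ((m : ℝ) - α) m * Ring.choose ((n : ℝ) + α) n :
        ℝ) : ℂ) * cexp (↑((α - m - 1) * θ) * I) * (1 - cexp (↑θ * I)) ^ n := by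
  have hp : ∑ ν ∈ range (m + 1), ((Ring.choose ((m : ℝ) - α) (m - ν) *
      Ring.choose ((n : ℝ) + α) ν * Ring.choose (ν : ℝ) (m + 1) : ℝ) : ℂ) *
        cexp (↑(((ν : ℝ) - ↑(m + 1)) * θ) * I) = 0 := by
    refine sum_eq_zero fun ν hν => ?_
    rw [ring_choose_natCast_of_lt (mem_range.mp hν), mul_zero, Complex.ofReal_zero, zero_mul]
  have hq : ∀ ν ∈ range (n + 1), ((Ring.choose ((m : ℝ) - α) ν *
      Ring.choose ((n : ℝ) + α) (n - ν) * Ring.choose ((ν : ℝ) + α) (m + 1) : ℝ) : ℂ) *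
        cexp (↑(((ν : ℝ) + α - ↑(m + 1)) * θ) * I) =
      cexp (↑((α - m - 1) * θ) * I) * (((Ring.choose ((m : ℝ) - α) ν *
        Ring.choose ((n : ℝ) + α) (n - ν) * Ring.choose ((ν : ℝ) + α) (m + 1) : ℝ) : ℂ) *
          cexp (↑θ * I) ^ ν) := by
    intro ν _
    have : cexp (↑(((ν : ℝ) + α - ↑(m + 1)) * θ) * I) =
        cexp (↑((α - m - 1) * θ) * I) * cexp (↑θ * I) ^ ν := by
      rw [← cexp_add_natCast_mul_I]
      congr 1
      push_cast
      ring
    rw [this]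
    ring
  rw [hp, sub_zero, sum_congr rfl hq, ← mul_sum, sum_qcoeff_mul_choose_succ_mul_pow α hnm]
  ring

/-! ### The remainder formula (Lemma 2 / Lemma 3) along the arc -/

/-- **Padé remainder along the arc** [cite: ChenVoutier1997, Lemma 2 (with Lemma 3's use of it
at `x = w` on the unit circle)]: for `n ≤ m`, real `α` and real `φ`, with
`p_m(X) = ∑ C(m-α,m-ν)C(n+α,ν)X^ν`, `q_n(X) = ∑ C(m-α,ν)C(n+α,n-ν)X^ν`,
`e^{iαφ} q_n(e^{iφ}) - p_m(e^{iφ})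
  = (-1)^m α C(m-α,m) C(n+α,n) · i ∫_0^φ e^{i(α-m)θ} (1-e^{iθ})^n (e^{iφ}-e^{iθ})^m dθ`,
which is the printed `α C(m-α,m) C(n+α,n) ∫_1^x (t-x)^m (1-t)^n t^{α-m-1} dt` with the path
`t = e^{iθ}`, `0 ≤ θ ≤ φ` (`dt = i e^{iθ} dθ`, `t^{α-m-1} = e^{i(α-m-1)θ}`). -/
theorem binomialPade_remainder_arc (α : ℝ) {m n : ℕ} (hnm : n ≤ m) (φ : ℝ) :
    cexp (↑(α * φ) * I) * ∑ ν ∈ range (n + 1),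
        ((Ring.choose ((m : ℝ) - α) ν * Ring.choose ((n : ℝ) + α) (n - ν) : ℝ) : ℂ) *
          cexp (↑φ * I) ^ ν -
      ∑ ν ∈ range (m + 1),
        ((Ring.choose ((m : ℝ) - α) (m - ν) * Ring.choose ((n : ℝ) + α) ν : ℝ) : ℂ) *
          cexp (↑φ * I) ^ ν =
    (((-1) ^ m * α * Ring.choose ((m : ℝ) - α) m * Ring.choose ((n : ℝ) + α) n : ℝ) : ℂ) * I *
      ∫ θ in (0 : ℝ)..φ, cexp (↑((α - m) * θ) * I) * (1 - cexp (↑θ * I)) ^ n *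
        (cexp (↑φ * I) - cexp (↑θ * I)) ^ m := by
  set x : ℂ := cexp (↑φ * I) with hx
  -- the Taylor coefficients along the arc, as an opaque function with its defining equation
  obtain ⟨f, hf⟩ : ∃ f : ℕ → ℝ → ℂ, f = fun k θ =>
      ∑ ν ∈ range (n + 1), ((Ring.choose ((m : ℝ) - α) ν * Ring.choose ((n : ℝ) + α) (n - ν) *
          Ring.choose ((ν : ℝ) + α) k : ℝ) : ℂ) * cexp (↑(((ν : ℝ) + α - k) * θ) * I) -
      ∑ ν ∈ range (m + 1), ((Ring.choose ((m : ℝ) - α) (m - ν) * Ring.choose ((n : ℝ) + α) ν *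
          Ring.choose (ν : ℝ) k : ℝ) : ℂ) * cexp (↑(((ν : ℝ) - k) * θ) * I) := ⟨_, rfl⟩
  have hfd : ∀ θ k, HasDerivAt (f k) ((k + 1) * f (k + 1) θ * (I * cexp (↑θ * I))) θ := by
    intro θ k
    rw [hf]
    exact hasDerivAt_padeTaylorCoeff α m n k θ
  -- the constant
  set K : ℝ := (-1) ^ m * (α / (m + 1)) * Ring.choose ((m : ℝ) - α) m *
    Ring.choose ((n : ℝ) + α) n with hK
  have hfm : ∀ θ, f (m + 1) θ = (K : ℂ) * cexp (↑((α - m - 1) * θ) * I) *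
      (1 - cexp (↑θ * I)) ^ n := by
    intro θ
    rw [hf]
    exact padeTaylorCoeff_succ α hnm θ
  -- H(θ) = ∑_{k ≤ m} f_k(θ) (x - e^{iθ})^k and its derivative
  set G : ℝ → ℂ := fun θ => ((m + 1 : ℝ) * K : ℝ) * I * (cexp (↑((α - m) * θ) * I) *
    (1 - cexp (↑θ * I)) ^ n * (x - cexp (↑θ * I)) ^ m) with hG
  have hH : ∀ θ, HasDerivAt (fun θ => ∑ k ∈ range (m + 1), f k θ * (x - cexp (↑θ * I)) ^ k)
      (G θ) θ := by
    intro θ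
    have h := hasDerivAt_taylor_telescope (m := m) (f := f) (x := x)
      (f' := fun k => (k + 1) * f (k + 1) θ * (I * cexp (↑θ * I)))
      (fun k _ => hfd θ k) (fun k _ => rfl) (hasDerivAt_cexp_I θ)
    refine h.congr_deriv ?_
    have he : cexp (↑((α - m - 1) * θ) * I) * cexp (↑θ * I) = cexp (↑((α - m) * θ) * I) :=
      cexp_sub_one_mul_I_mul (α - m) θ
    rw [hfm θ, hG]
    beta_reduce
    rw [← he]
    push_cast
    ring
  -- the fundamental theorem of calculus along the arc
  have hint : ∫ θ in (0 : ℝ)..φ, G θ =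
      (∑ k ∈ range (m + 1), f k φ * (x - cexp (↑φ * I)) ^ k) -
        ∑ k ∈ range (m + 1), f k 0 * (x - cexp (↑(0 : ℝ) * I)) ^ k := by
    refine integral_eq_sub_of_hasDerivAt (fun θ _ => hH θ) ?_
    refine Continuous.intervalIntegrable ?_ _ _
    rw [hG]
    fun_prop
  -- H(φ) = e^{iαφ} q(e^{iφ}) - p(e^{iφ})
  have hHφ : ∑ k ∈ range (m + 1), f k φ * (x - cexp (↑φ * I)) ^ k =
      cexp (↑(α * φ) * I) * ∑ ν ∈ range (n + 1),
        ((Ring.choose ((m : ℝ) - α) ν * Ring.choose ((n : ℝ) + α) (n - ν) : ℝ) : ℂ) * x ^ ν -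
      ∑ ν ∈ range (m + 1),
        ((Ring.choose ((m : ℝ) - α) (m - ν) * Ring.choose ((n : ℝ) + α) ν : ℝ) : ℂ) * x ^ ν := by
    rw [sum_range_succ', sum_eq_zero (fun k _ => by rw [← hx, sub_self, zero_pow (by omega),
      mul_zero]), zero_add, pow_zero, mul_one, hf]
    dsimp only
    simp only [Ring.choose_zero_right, mul_one, Nat.cast_zero, sub_zero]
    rw [mul_sum]
    congr 1
    · refine sum_congr rfl fun ν _ => ?_
      have : cexp (↑(((ν : ℝ) + α) * φ) * I) = cexp (↑(α * φ) * I) * x ^ ν := by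
        rw [hx, ← cexp_add_natCast_mul_I]
        congr 1
        push_cast
        ring
      rw [this]
      ring
    · refine sum_congr rfl fun ν _ => ?_
      rw [hx, cexp_natCast_mul_I]
  -- H(0) = 0 (the Padé property)
  have hH0 : ∑ k ∈ range (m + 1), f k 0 * (x - cexp (↑(0 : ℝ) * I)) ^ k = 0 := by
    refine sum_eq_zero fun k hk => ?_
    rw [hf]
    dsimp only
    rw [padeTaylorCoeff_zero α n (Nat.lt_succ_iff.mp (mem_range.mp hk)), zero_mul]
  -- assemble
  rw [← hHφ, ← sub_zero (∑ k ∈ range (m + 1), f k φ * (x - cexp (↑φ * I)) ^ k), ← hH0, ← hint,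
    hG, intervalIntegral.integral_const_mul, hK]
  push_cast
  field_simp

/-! ### The bound of Lemma 5 -/

/-- **Bound for the Padé remainder on the arc** [cite: ChenVoutier1997, Lemma 5 (with the
normalisation of Lemma 2)]: for `m = n = r`, real `α` and `0 ≤ φ ≤ 2π`,
`‖e^{iαφ} q_r(e^{iφ}) - p_r(e^{iφ})‖ ≤ |α C(r-α,r) C(r+α,r)| · φ · |1 - e^{iφ/2}|^{2r}`.
(In the notation of Lemma 3/Lemma 5, `w = e^{iφ}`, `√w = e^{iφ/2}`, `w^{1/n} = e^{iφ/n}`, and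
dividing by `C(r-1/n,r)` gives `|R_{n,r}(w)| ≤ (Γ(r+1+1/n)/(r! Γ(1/n))) φ |1-√w|^{2r}` since
`(1/n) C(r+1/n,r) = Γ(r+1+1/n)/(r! Γ(1/n))`.) -/
theorem binomialPade_remainder_arc_norm_le (α : ℝ) (r : ℕ) {φ : ℝ} (hφ0 : 0 ≤ φ)
    (hφ : φ ≤ 2 * Real.pi) :
    ‖cexp (↑(α * φ) * I) * ∑ ν ∈ range (r + 1),
        ((Ring.choose ((r : ℝ) - α) ν * Ring.choose ((r : ℝ) + α) (r - ν) : ℝ) : ℂ) *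
          cexp (↑φ * I) ^ ν -
      ∑ ν ∈ range (r + 1),
        ((Ring.choose ((r : ℝ) - α) (r - ν) * Ring.choose ((r : ℝ) + α) ν : ℝ) : ℂ) *
          cexp (↑φ * I) ^ ν‖ ≤
    |α * (Ring.choose ((r : ℝ) - α) r * Ring.choose ((r : ℝ) + α) r)| * φ *
      ‖1 - cexp (↑(φ / 2) * I)‖ ^ (2 * r) := by
  rw [binomialPade_remainder_arc α le_rfl φ, norm_mul, norm_mul, Complex.norm_I, mul_one,
    Complex.norm_real, Real.norm_eq_abs]
  have hI : ‖∫ θ in (0 : ℝ)..φ, cexp (↑((α - r) * θ) * I) * (1 - cexp (↑θ * I)) ^ r *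
      (cexp (↑φ * I) - cexp (↑θ * I)) ^ r‖ ≤ ‖1 - cexp (↑(φ / 2) * I)‖ ^ (2 * r) * |φ - 0| := by
    refine norm_integral_le_of_norm_le_const fun θ hθ => ?_
    rw [Set.uIoc_of_le hφ0] at hθ
    rw [norm_mul, norm_mul, norm_exp_ofReal_mul_I, one_mul, norm_pow, norm_pow, ← mul_pow,
      pow_mul]
    exact pow_le_pow_left₀ (by positivity)
      (norm_one_sub_cexp_mul_norm_sub_le hθ.1.le hθ.2 hφ) r
  rw [sub_zero, abs_of_nonneg hφ0] at hI
  have habs : |(-1 : ℝ) ^ r * α * Ring.choose ((r : ℝ) - α) r * Ring.choose ((r : ℝ) + α) r| =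
      |α * (Ring.choose ((r : ℝ) - α) r * Ring.choose ((r : ℝ) + α) r)| := by
    rw [show (-1 : ℝ) ^ r * α * Ring.choose ((r : ℝ) - α) r * Ring.choose ((r : ℝ) + α) r =
      (-1) ^ r * (α * (Ring.choose ((r : ℝ) - α) r * Ring.choose ((r : ℝ) + α) r)) by ring,
      abs_mul, abs_pow, abs_neg, abs_one, one_pow, one_mul]
  rw [habs]
  calc _ ≤ |α * (Ring.choose ((r : ℝ) - α) r * Ring.choose ((r : ℝ) + α) r)| *
        (‖1 - cexp (↑(φ / 2) * I)‖ ^ (2 * r) * φ) :=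
        mul_le_mul_of_nonneg_left hI (abs_nonneg _)
    _ = _ := by ring

end Literature.NumberTheory.DiophantineApproximation
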